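import Mathlib

/-!
# Coupled-pair unique continuation from the vector statement (stub `correctorKill_pairUCP`)

Helper for the crux
`Summit.NavierStokesRegularity.NavierStokesRegularity.Theses.AdiabaticEddy.CorrectorSolvable`
(stmt-NavierStokesRegularity-1429, route AdiabaticEddy, line `Sketch`).

If unique continuation from an open zero set holds for `C²` maps `v : ℝ³ → ℝᵐ` (every `m`) subject
to `‖Δv‖ ≤ C_R (‖v‖ + ‖Dv‖)` on the balls `B(x₀, R)`, then a `C²` pair `U : ℝ³ → ℝ³`, `Q : ℝ³ → ℝ`
with the COUPLED inequalities `‖ΔU‖, ‖ΔQ‖ ≤ C_R (‖U‖ + ‖DU‖ + ‖Q‖ + ‖DQ‖)` on every `B(x₀, R)` and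
`U = Q = 0` on some `B(x₀, δ)` has `U = 0`.  Proof: package the pair as `v := Ψ ∘ (U, Q)` for a
continuous linear equivalence `Ψ : ℝ³ × ℝ ≃L[ℝ] ℝᵐ`, `m = finrank ℝ (ℝ³ × ℝ)` (`toEuclidean`); the
Laplacian and the derivative commute with `Ψ` and with the two coordinate projections `P₁, P₂`
(read through `Ψ⁻¹`), so the coupled inequalities transfer to `v` with the constant
`2 ‖Ψ‖ C (‖P₁‖ + ‖P₂‖)`, and `v = 0` gives `U = P₁ ∘ v = 0`.
-/

noncomputable section

-- the summit-side namespace `Summit.NavierStokesRegularity.NavierStokesRegularity.…` repeats a component by design (D-0017)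
set_option linter.dupNamespace false

namespace Summit.NavierStokesRegularity.NavierStokesRegularity.Theorems

open Set Metric InnerProductSpace

/-- **Packaging a coupled pair into one vector unknown.** If the vector unique-continuation
statement (`C²` maps `v : ℝ³ → ℝᵐ` with `‖Δv‖ ≤ C_R (‖v‖ + ‖Dv‖)` on every ball `B(x₀, R)` and
`v = 0` on some ball `B(x₀, δ)` vanish identically) holds for every `m`, then a `C²` pair
`U : ℝ³ → ℝ³`, `Q : ℝ³ → ℝ` with the COUPLED inequalities
`‖ΔU‖, ‖ΔQ‖ ≤ C_R (‖U‖ + ‖DU‖ + ‖Q‖ + ‖DQ‖)` on every ball `B(x₀, R)` and `U = Q = 0` on some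
`B(x₀, δ)` has `U = 0`: apply the vector statement to `v := Ψ ∘ (U, Q)` for a continuous linear
equivalence `Ψ : ℝ³ × ℝ ≃L[ℝ] ℝᵐ` (`Δ` and `D` commute with `Ψ` and with the coordinate projections;
all comparison constants are operator norms). [folklore] -/
theorem correctorKill_pairUCP
    (hvec : ∀ (m : ℕ) (v : EuclideanSpace ℝ (Fin 3) → EuclideanSpace ℝ (Fin m))
      (x₀ : EuclideanSpace ℝ (Fin 3)), ContDiff ℝ 2 v →
      (∀ R : ℝ, 0 < R → ∃ C : ℝ, ∀ y ∈ Metric.ball x₀ R,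
        ‖Laplacian.laplacian v y‖ ≤ C * (‖v y‖ + ‖fderiv ℝ v y‖)) →
      (∃ δ : ℝ, 0 < δ ∧ ∀ y ∈ Metric.ball x₀ δ, v y = 0) → v = 0)
    (U : EuclideanSpace ℝ (Fin 3) → EuclideanSpace ℝ (Fin 3)) (Q : EuclideanSpace ℝ (Fin 3) → ℝ)
    (x₀ : EuclideanSpace ℝ (Fin 3)) (hU : ContDiff ℝ 2 U) (hQ : ContDiff ℝ 2 Q)
    (hineq : ∀ R : ℝ, 0 < R → ∃ C : ℝ, 0 ≤ C ∧ ∀ y ∈ Metric.ball x₀ R,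
      ‖Laplacian.laplacian U y‖ ≤ C * (‖U y‖ + ‖fderiv ℝ U y‖ + ‖Q y‖ + ‖fderiv ℝ Q y‖) ∧
      ‖Laplacian.laplacian Q y‖ ≤ C * (‖U y‖ + ‖fderiv ℝ U y‖ + ‖Q y‖ + ‖fderiv ℝ Q y‖))
    (hvan : ∃ δ : ℝ, 0 < δ ∧ ∀ y ∈ Metric.ball x₀ δ, U y = 0 ∧ Q y = 0) :
    U = 0 := by
  -- a continuous linear equivalence `Ψ : ℝ³ × ℝ ≃L ℝᵐ`, `m = finrank ℝ (ℝ³ × ℝ)` (opaque)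
  obtain ⟨Ψ⟩ : Nonempty ((EuclideanSpace ℝ (Fin 3) × ℝ) ≃L[ℝ]
      EuclideanSpace ℝ (Fin (Module.finrank ℝ (EuclideanSpace ℝ (Fin 3) × ℝ)))) := ⟨toEuclidean⟩
  -- the two coordinate projections, read through `Ψ⁻¹`
  obtain ⟨P₁, hP₁⟩ : ∃ P₁ : EuclideanSpace ℝ (Fin (Module.finrank ℝ (EuclideanSpace ℝ (Fin 3) × ℝ)))
      →L[ℝ] EuclideanSpace ℝ (Fin 3), ∀ z, P₁ (Ψ z) = z.1 :=
    ⟨(ContinuousLinearMap.fst ℝ (EuclideanSpace ℝ (Fin 3)) ℝ).comp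
      (Ψ.symm : _ →L[ℝ] EuclideanSpace ℝ (Fin 3) × ℝ), fun z => by simp⟩
  obtain ⟨P₂, hP₂⟩ : ∃ P₂ : EuclideanSpace ℝ (Fin (Module.finrank ℝ (EuclideanSpace ℝ (Fin 3) × ℝ)))
      →L[ℝ] ℝ, ∀ z, P₂ (Ψ z) = z.2 :=
    ⟨(ContinuousLinearMap.snd ℝ (EuclideanSpace ℝ (Fin 3)) ℝ).comp
      (Ψ.symm : _ →L[ℝ] EuclideanSpace ℝ (Fin 3) × ℝ), fun z => by simp⟩
  -- the pair as one map into the normed space `ℝ³ × ℝ`, and its transport `v` to `ℝᵐ`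
  set p : EuclideanSpace ℝ (Fin 3) → EuclideanSpace ℝ (Fin 3) × ℝ := fun y => (U y, Q y) with hpdef
  set v : EuclideanSpace ℝ (Fin 3) →
      EuclideanSpace ℝ (Fin (Module.finrank ℝ (EuclideanSpace ℝ (Fin 3) × ℝ))) := Ψ ∘ p with hvdef
  have hp : ContDiff ℝ 2 p := hU.prodMk hQ
  have hv : ContDiff ℝ 2 v := Ψ.contDiff.comp hp
  have hvd : Differentiable ℝ v := hv.differentiable (by norm_num)
  have hUv : U = P₁ ∘ v := by
    funext y
    simp [hvdef, hpdef, hP₁]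
  have hQv : Q = P₂ ∘ v := by
    funext y
    simp [hvdef, hpdef, hP₂]
  -- comparison of `U`, `Q` and their derivatives with `v`
  have hU_le : ∀ y, ‖U y‖ ≤ ‖P₁‖ * ‖v y‖ := fun y => by
    rw [hUv]
    exact P₁.le_opNorm (v y)
  have hQ_le : ∀ y, ‖Q y‖ ≤ ‖P₂‖ * ‖v y‖ := fun y => by
    rw [hQv]
    exact P₂.le_opNorm (v y)
  have hDU_le : ∀ y, ‖fderiv ℝ U y‖ ≤ ‖P₁‖ * ‖fderiv ℝ v y‖ := fun y => by
    have h : fderiv ℝ U y = P₁.comp (fderiv ℝ v y) := by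
      rw [hUv]
      exact (P₁.hasFDerivAt.comp y (hvd y).hasFDerivAt).fderiv
    rw [h]
    exact P₁.opNorm_comp_le _
  have hDQ_le : ∀ y, ‖fderiv ℝ Q y‖ ≤ ‖P₂‖ * ‖fderiv ℝ v y‖ := fun y => by
    have h : fderiv ℝ Q y = P₂.comp (fderiv ℝ v y) := by
      rw [hQv]
      exact (P₂.hasFDerivAt.comp y (hvd y).hasFDerivAt).fderiv
    rw [h]
    exact P₂.opNorm_comp_le _
  -- the Laplacian of `v` is `Ψ` applied to the pair of Laplacians
  have hΔv : ∀ y, Laplacian.laplacian v y = Ψ (Laplacian.laplacian p y) := fun y =>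
    congrFun (laplacian_CLE_comp_left (l := Ψ) (f := p)) y
  have hΔp : ∀ y, ‖Laplacian.laplacian p y‖ ≤
      ‖Laplacian.laplacian U y‖ + ‖Laplacian.laplacian Q y‖ := fun y => by
    have h1 : (Laplacian.laplacian p y).1 = Laplacian.laplacian U y :=
      ((hp.contDiffAt (x := y)).laplacian_CLM_comp_left
        (l := ContinuousLinearMap.fst ℝ (EuclideanSpace ℝ (Fin 3)) ℝ)).symm
    have h2 : (Laplacian.laplacian p y).2 = Laplacian.laplacian Q y :=
      ((hp.contDiffAt (x := y)).laplacian_CLM_comp_left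
        (l := ContinuousLinearMap.snd ℝ (EuclideanSpace ℝ (Fin 3)) ℝ)).symm
    rw [Prod.norm_def, h1, h2]
    exact max_le (le_add_of_nonneg_right (norm_nonneg _)) (le_add_of_nonneg_left (norm_nonneg _))
  -- unique continuation for `v`
  have hv0 : v = 0 := by
    refine hvec _ v x₀ hv ?_ ?_
    · intro R hR
      obtain ⟨C, hC0, hC⟩ := hineq R hR
      refine ⟨2 * ‖Ψ.toContinuousLinearMap‖ * C * (‖P₁‖ + ‖P₂‖), fun y hy => ?_⟩
      obtain ⟨hCU, hCQ⟩ := hC y hy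
      have hST : ‖U y‖ + ‖fderiv ℝ U y‖ + ‖Q y‖ + ‖fderiv ℝ Q y‖ ≤
          (‖P₁‖ + ‖P₂‖) * (‖v y‖ + ‖fderiv ℝ v y‖) := by
        calc ‖U y‖ + ‖fderiv ℝ U y‖ + ‖Q y‖ + ‖fderiv ℝ Q y‖
            ≤ ‖P₁‖ * ‖v y‖ + ‖P₁‖ * ‖fderiv ℝ v y‖ + ‖P₂‖ * ‖v y‖ +
                ‖P₂‖ * ‖fderiv ℝ v y‖ :=
              add_le_add (add_le_add (add_le_add (hU_le y) (hDU_le y)) (hQ_le y)) (hDQ_le y)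
          _ = (‖P₁‖ + ‖P₂‖) * (‖v y‖ + ‖fderiv ℝ v y‖) := by ring
      calc ‖Laplacian.laplacian v y‖ = ‖Ψ (Laplacian.laplacian p y)‖ := by rw [hΔv]
        _ ≤ ‖Ψ.toContinuousLinearMap‖ * ‖Laplacian.laplacian p y‖ :=
            Ψ.toContinuousLinearMap.le_opNorm _
        _ ≤ ‖Ψ.toContinuousLinearMap‖ * (C * (‖U y‖ + ‖fderiv ℝ U y‖ + ‖Q y‖ + ‖fderiv ℝ Q y‖) +
              C * (‖U y‖ + ‖fderiv ℝ U y‖ + ‖Q y‖ + ‖fderiv ℝ Q y‖)) :=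
            mul_le_mul_of_nonneg_left ((hΔp y).trans (add_le_add hCU hCQ)) (norm_nonneg _)
        _ ≤ ‖Ψ.toContinuousLinearMap‖ * (C * ((‖P₁‖ + ‖P₂‖) * (‖v y‖ + ‖fderiv ℝ v y‖)) +
              C * ((‖P₁‖ + ‖P₂‖) * (‖v y‖ + ‖fderiv ℝ v y‖))) :=
            mul_le_mul_of_nonneg_left (add_le_add (mul_le_mul_of_nonneg_left hST hC0)
              (mul_le_mul_of_nonneg_left hST hC0)) (norm_nonneg _)
        _ = 2 * ‖Ψ.toContinuousLinearMap‖ * C * (‖P₁‖ + ‖P₂‖) * (‖v y‖ + ‖fderiv ℝ v y‖) := by ring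
    · obtain ⟨δ, hδ, hball⟩ := hvan
      refine ⟨δ, hδ, fun y hy => ?_⟩
      obtain ⟨hUy, hQy⟩ := hball y hy
      simp [hvdef, hpdef, hUy, hQy]
  -- read off `U = P₁ ∘ v = 0`
  rw [hUv, hv0]
  funext y
  simp

end Summit.NavierStokesRegularity.NavierStokesRegularity.Theorems

end
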